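import Summits.QuantumFields.YangMills.Theorems.UnitScaleTiltHalvingP1FlatPillar
import Literature.MathematicalPhysics.QuantumFieldTheory.Balaban1983to89.CentreTwistBlockAvg
import Literature.MathematicalPhysics.QuantumFieldTheory.Balaban1983to89.T3CentreSymmetry
import Literature.MathematicalPhysics.QuantumFieldTheory.Balaban1983to89.T3DescentFibreTower
import Literature.MathematicalPhysics.QuantumFieldTheory.Balaban1983to89.B11Thm1LevelZero
import HarnessLib

/-!
# Route `UnitScaleTilt`, crux K1 child «MinimiserStabilityRegPr» (stmt-QuantumFields-19200), registered stub `stub_halvingStep` (H) —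
# HAZARD «hP1-HOLONOMY» (★★OWNER RULING g26-№27), STAGE 1: **THE WRAP WITNESS** — an admissible datum of the pillar text `P1FlatPillar` with CENTRAL
# HOLONOMY `−1` along a straight fine cycle (positive bricks, reusable by the «H-SMALL» route (R-b))

The datum is the 't Hooft SHEET of the trivial configuration, `U := (1 : GaugeField (F.P K) 0 SU(2)).ctwist negOne₂ μ s₀` ([tHooft1979Flux] §2: the bonds in direction
`μ` issuing from the slice `x_μ = s₀` carry the centre element `−1`; gauge-equivalent to the flat constant abelian connection with holonomy `−1`).  The tree carries it
end to end: every plaquette is `1` (`CentreTwist.plaqHol_ctwist`), the `(K−n)`-fold (0.4)-average of a fine sheet is a coarse sheet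
(`CentreTwistBlockAvg.exists_iter_blockAvg_ctwist`, `T3DescentFibreTower.avgFun_one`), so:

* §1 `plaqHol_ctwist_one`, `plaqSmall_ctwist_one` — the sheet is flat, in every window `PlaqSmall δ`, `δ > 0`;
* §2 ★`regPr_ctwist_one` — it lies in print's regular space `RegPr F n K ε₀` for EVERY `ε₀ > 0` (divergence clause: `B11Thm1LevelZero.norm_covDivT_toUField_le` at every window);
  `iter_blockAvg_one`; ★`exists_plaqSmall_descendTo_ctwist_one` — for some fine slice `s₀` its descent `D_{n,K}U` is in every `PlaqSmall δ` (so `(V := D_{n,K}U, U)` is an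
  admissible (7)∕(6)-datum of `P1FlatPillar` at every `(ε₁, ε₀)`);
* §3 the straight cycle `i ↦ 0 + (s₀ + i)e_μ` through the sheet: `transl_cycle_succ` (one step = the `μ`-shift), `transl_cycle_apply(_ne)`, ★`transl_cycle_period` (it closes after
  `N = sitesPerDir 0` steps), `ctwist_one_cycle_zero`∕`_pos` (the first bond carries `−1`, the other `N − 1` carry `1`), `val_unitsField_cycle_zero`, `unitsField_cycle_pos`
  (the same read in `M₂(ℂ)ˣ`, the currency of the pillar's chart identity (ii));
* §4 WRAPPING members (`sitesPerDir (K−n) ≤ 2ρ + 1`): `distSite_le_half`, ★`mem_cubeFinM_top_of_wrap` (the top cube `□_{K−n}` of the aligned sequence of ANY centre is the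
  whole top torus), `inOm_top_of_wrap`, `levOf_top_of_wrap`, ★`levWeight_one_of_wrap` (every (152)-weight is `1` at first order), ★`sideTouches_top_of_wrap` (every fine bond
  side-touches the top layer — so (ii) of `P1FlatPillarAt` is asked on EVERY bond);
* §5 algebra: `prod_telescope` (`gᵢ⁻¹Wᵢgᵢ₊₁ = Eᵢ` ⇒ `g₀⁻¹(∏W)g_N = ∏E`), `prod_range_map_eq_head`, `norm_list_prod_sub_one_le` (`‖∏Xᵢ − 1‖ ≤ (1+t)^n − 1`).

Stage 2 (`…HalvingP1FlatPillarWrapNegative`) draws the contradiction: `¬ P1FlatPillar 3 ρ …` (`ρ ≥ 3`), `¬ P1FlatPillar′ 3 ρ …`, and `hP1_false` (the H-door's binder, verbatim, negated).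

Cell `ym3-torus` (HUMAN RULING D-0037, YM ladder rung R3 — continuum SU(2) YM₃ on the torus is a RUNG, not the Clay problem, not `d = 4`, not a gap), width seat
`ym-ust-20520-w1` gen 6; `--supports stmt-QuantumFields-19200 --as helper`; def-free, 0 sorry, standard axioms.  HONEST SCOPE: bookkeeping about one explicit flat datum; no
registered item is refuted (the H stub's conclusion is gauge-invariant and holds trivially at this datum); what it exhibits is that a background-`1` chart cannot exist on
a member whose top cube wraps — the located hazard behind the «room» binder (R-a) and the residual «H-SMALL» (R-b).

References: G. 't Hooft, Nucl. Phys. B **153** (1979) 141 [tHooft1979Flux] §2; T. Bałaban, CMP **109** (1987) [Balaban1987RG1] (0.4) p.253, (0.11) p.253, (2.17) p.269;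
CMP **102** (1985) [Balaban1985Variational] (2) p.278, (144) p.300, (152) p.301; CMP **99** (1985) [Balaban1985RegularSpaces] (1.9) p.77, Thm 2 p.83;
CMP **98** (1985) [Balaban1985Averaging] (19) p.21; CMP **95** (1984) [Balaban1984PropagatorsI] (1.110) p.35.
-/

set_option autoImplicit false

noncomputable section

open scoped BigOperators Matrix.Norms.L2Operator

namespace Summit.QuantumFields.YangMills.Theorems.HalvingP1FlatPillarWrapWitness

open Literature.MathematicalPhysics.QuantumFieldTheory.Balaban1983to89
open Literature.MathematicalPhysics.QuantumFieldTheory.Balaban1983to89.T3ContinuumYM3Torus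
open Literature.MathematicalPhysics.QuantumFieldTheory.Balaban1983to89.T3PrintedRegularMinimiser
open Literature.MathematicalPhysics.QuantumFieldTheory.Balaban1983to89.T3RegularMinimiser
open Literature.MathematicalPhysics.QuantumFieldTheory.Balaban1983to89.T3ConstrainedMinimiser
open Literature.MathematicalPhysics.QuantumFieldTheory.Balaban1983to89.T3TiltDescent
open Literature.MathematicalPhysics.QuantumFieldTheory.Balaban1983to89.T3DescentFibreTower
open Literature.MathematicalPhysics.QuantumFieldTheory.Balaban1983to89.T3UnitLawDensityEML (ℰp)
open Literature.MathematicalPhysics.QuantumFieldTheory.Balaban1983to89.T3CruxEstimates (plaqSmall_fieldShift)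
open Literature.MathematicalPhysics.QuantumFieldTheory.Balaban1983to89.T3LowerAlongMinimisersSplit (L_cast_pos)
open B10Eq27TorusAxialLog (transl transl_apply unitsField toUField transl_add_e val_unitsField val_suIncl)
open B10Eq68TorusRegularity (covDivT)
open B7Prop1Explicit (e e_apply expUnit)

/-! ## §1 The 't Hooft sheet of the trivial configuration is flat -/

section Flat

variable {P : Params} {j : ℕ}

/-- Every plaquette variable of the centre-twisted trivial configuration is `1`. [cite: tHooft1979Flux, §2] -/
theorem plaqHol_ctwist_one (μ : Fin P.d) (s : ZMod (P.sitesPerDir j)) (p : Plaq P j) :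
    ((1 : GaugeField P j (Matrix.specialUnitaryGroup (Fin 2) ℂ)).ctwist negOne₂ μ s).plaqHol p = 1 := by
  rw [GaugeField.plaqHol_ctwist negOne₂_comm]
  show (1 : Matrix.specialUnitaryGroup (Fin 2) ℂ) * 1 * (1 : Matrix.specialUnitaryGroup (Fin 2) ℂ)⁻¹ * (1 : _)⁻¹ = 1
  simp

/-- Hence it lies in every plaquette window `PlaqSmall δ`, `δ > 0`. [cite: tHooft1979Flux, §2; Balaban1987RG1, (0.18) p.255] -/
theorem plaqSmall_ctwist_one {δ : ℝ} (hδ : 0 < δ) (μ : Fin P.d) (s : ZMod (P.sitesPerDir j)) :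
    PlaqSmall δ ((1 : GaugeField P j (Matrix.specialUnitaryGroup (Fin 2) ℂ)).ctwist negOne₂ μ s) := fun p => by
  rw [plaqHol_ctwist_one, GaugeGroup.dist1_one]; exact hδ

end Flat

/-! ## §2 It lies in print's regular space `RegPr` at every radius, and its descent is flat -/

section Regular

variable (F : T3Family) (n K : ℕ)

/-- The sheet configuration is in `RegPr F n K ε₀` for every `ε₀ > 0`: the plaquette clause by §1, the divergence clause because the covariant
divergence of an identically trivial plaquette field vanishes (`norm_covDivT_toUField_le` at every window `δ → 0`).
[cite: Balaban1985Variational, (2) p.278; Balaban1985RegularSpaces, (1.9) p.77] -/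
theorem regPr_ctwist_one {ε₀ : ℝ} (hε₀ : 0 < ε₀) (μ : Fin (F.P K).d) (s : ZMod ((F.P K).sitesPerDir 0)) :
    RegPr F n K ε₀ ((1 : GaugeField (F.P K) 0 (Matrix.specialUnitaryGroup (Fin 2) ℂ)).ctwist negOne₂ μ s) := by
  have hL : (0 : ℝ) < F.L := L_cast_pos F
  refine ⟨plaqSmall_ctwist_one (mul_pos hε₀ (pow_pos (inv_pos.2 hL) _)) μ s, fun b => ?_⟩
  have h0 : ‖covDivT 1 (unitsField (toUField ((1 : GaugeField (F.P K) 0 (Matrix.specialUnitaryGroup (Fin 2) ℂ)).ctwist negOne₂ μ s)))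
      b.dir b.src‖ ≤ 0 := by
    refine le_of_forall_pos_lt_add fun ε hε => ?_
    set c : ℝ := 2 * (((F.P K).d - 1 : ℕ) : ℝ) with hc
    have hc0 : 0 ≤ c := by positivity
    have h := B11Thm1LevelZero.norm_covDivT_toUField_le
      ((1 : GaugeField (F.P K) 0 (Matrix.specialUnitaryGroup (Fin 2) ℂ)).ctwist negOne₂ μ s) one_pos
      (plaqSmall_ctwist_one (show 0 < ε / (c + 1) by positivity) μ s) b.dir b.src
    rw [inv_one, one_mul] at h
    calc _ ≤ c * (ε / (c + 1)) := h
      _ < 0 + ε := by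
        rw [zero_add, mul_div_assoc']
        rw [div_lt_iff₀ (by positivity)]
        nlinarith
  exact h0.trans_lt (mul_pos hε₀ (pow_pos (inv_pos.2 hL) _))

/-- Iterated (0.4)-averages of the trivial configuration are trivial (`avgFun_one` with `exp[mean log 1] = 1`). [cite: Balaban1987RG1, (0.4) p.253] -/
theorem iter_blockAvg_one (k : ℕ) :
    Averaging.iter (fun i => BlockAveraging.blockAvg (P := F.P K) (j := i) ℰp) k
      (1 : GaugeField (F.P K) 0 (Matrix.specialUnitaryGroup (Fin 2) ℂ)) = 1 := by
  induction k with
  | zero => rfl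
  | succ k ih =>
    show (BlockAveraging.blockAvg ℰp).avg
        (Averaging.iter (fun i => BlockAveraging.blockAvg (P := F.P K) (j := i) ℰp) k 1) = 1
    rw [ih, BlockAveraging.blockAvg_avg, avgFun_one ℰp (fun n => expMeanLogSU_E_one n)]

/-- **THE DESCENT OF A SHEET IS A SHEET, HENCE FLAT**: for some fine slice `s₀`, the `(K−n)`-fold (0.4)-descent of the twisted trivial configuration
is the twisted trivial configuration of the `n`-th approximation (`CentreTwistBlockAvg.exists_iter_blockAvg_ctwist`), so it lies in every window
`PlaqSmall δ`, `δ > 0`. [cite: Balaban1987RG1, (2.17) p.269, (0.11) p.253; tHooft1979Flux, §2] -/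
theorem exists_plaqSmall_descendTo_ctwist_one (h : n ≤ K) (μ : Fin (F.P K).d) :
    ∃ s₀ : ZMod ((F.P K).sitesPerDir 0), ∀ δ : ℝ, 0 < δ →
      PlaqSmall δ (descendTo F ℰp n K h ((1 : GaugeField (F.P K) 0 (Matrix.specialUnitaryGroup (Fin 2) ℂ)).ctwist negOne₂ μ s₀)) := by
  obtain ⟨s₀, hs₀⟩ := BlockAveraging.exists_iter_blockAvg_ctwist (P := F.P K) ℰp negOne₂_comm μ (K - n)
    (by show K - n ≤ F.m + K; omega) 0
  refine ⟨s₀, fun δ hδ => ?_⟩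
  unfold descendTo
  refine (plaqSmall_fieldShift F _ δ _).mpr ?_
  rw [hs₀, iter_blockAvg_one]
  exact plaqSmall_ctwist_one hδ μ 0

end Regular

/-! ## §3 The straight cycle through the sheet and the bond variables along it -/

section Cycle

variable {P : Params} (μ : Fin P.d) (s₀ : ZMod (P.sitesPerDir 0))

/-- One step along the cycle is the `μ`-shift. [cite: Balaban1987RG1, (0.1) p.251] -/
theorem transl_cycle_succ (i : ℕ) :
    transl (0 : Site P 0) (((s₀.val : ℤ) + ((i + 1 : ℕ) : ℤ)) • e μ) = (transl (0 : Site P 0) (((s₀.val : ℤ) + (i : ℤ)) • e μ)).shift μ := by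
  have : ((s₀.val : ℤ) + ((i + 1 : ℕ) : ℤ)) • e μ = ((s₀.val : ℤ) + (i : ℤ)) • e μ + e μ := by
    rw [show ((s₀.val : ℤ) + ((i + 1 : ℕ) : ℤ)) = ((s₀.val : ℤ) + (i : ℤ)) + 1 by push_cast; ring, add_smul, one_smul]
  rw [this]
  exact transl_add_e _ _ _

/-- The `μ`-coordinate of the `i`-th site of the cycle is `s₀ + i`. [cite: Balaban1987RG1, (0.1) p.251] -/
theorem transl_cycle_apply (i : ℕ) : transl (0 : Site P 0) (((s₀.val : ℤ) + (i : ℤ)) • e μ) μ = s₀ + (i : ZMod (P.sitesPerDir 0)) := by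
  rw [transl_apply]
  have h0 : (0 : Site P 0) μ = 0 := rfl
  simp [h0, e_apply]

/-- The other coordinates of the sites of the cycle vanish. [cite: Balaban1987RG1, (0.1) p.251] -/
theorem transl_cycle_apply_ne (i : ℕ) {ν : Fin P.d} (hν : ν ≠ μ) : transl (0 : Site P 0) (((s₀.val : ℤ) + (i : ℤ)) • e μ) ν = 0 := by
  rw [transl_apply]
  have h0 : (0 : Site P 0) ν = 0 := rfl
  simp [h0, e_apply, hν]

/-- **THE CYCLE CLOSES after `N = sitesPerDir 0` steps** (periodicity of the torus). [cite: Balaban1987RG1, (0.1) p.251] -/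
theorem transl_cycle_period :
    transl (0 : Site P 0) (((s₀.val : ℤ) + ((P.sitesPerDir 0 : ℕ) : ℤ)) • e μ) = transl (0 : Site P 0) (((s₀.val : ℤ) + ((0 : ℕ) : ℤ)) • e μ) := by
  funext ν
  by_cases hν : ν = μ
  · subst hν
    rw [transl_cycle_apply, transl_cycle_apply, ZMod.natCast_self, Nat.cast_zero]
  · rw [transl_cycle_apply_ne μ s₀ _ hν, transl_cycle_apply_ne μ s₀ _ hν]

/-- The FIRST bond of the cycle is the twisted one: its variable is `−1`. [cite: tHooft1979Flux, §2] -/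
theorem ctwist_one_cycle_zero :
    (1 : GaugeField P 0 (Matrix.specialUnitaryGroup (Fin 2) ℂ)).ctwist negOne₂ μ s₀
      ⟨transl (0 : Site P 0) (((s₀.val : ℤ) + ((0 : ℕ) : ℤ)) • e μ), μ⟩ = negOne₂ := by
  have hc : transl (0 : Site P 0) (((s₀.val : ℤ) + ((0 : ℕ) : ℤ)) • e μ) μ = s₀ := by
    rw [transl_cycle_apply, Nat.cast_zero, add_zero]
  rw [GaugeField.ctwist_apply, if_pos ⟨rfl, hc⟩]
  exact mul_one _

/-- The other `N − 1` bonds of the cycle are untwisted: their variables are `1`. [cite: tHooft1979Flux, §2] -/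
theorem ctwist_one_cycle_pos {i : ℕ} (hi : 0 < i) (hiN : i < P.sitesPerDir 0) :
    (1 : GaugeField P 0 (Matrix.specialUnitaryGroup (Fin 2) ℂ)).ctwist negOne₂ μ s₀
      ⟨transl (0 : Site P 0) (((s₀.val : ℤ) + (i : ℤ)) • e μ), μ⟩ = 1 := by
  have hc : transl (0 : Site P 0) (((s₀.val : ℤ) + (i : ℤ)) • e μ) μ ≠ s₀ := by
    rw [transl_cycle_apply, Ne, add_eq_left, ZMod.natCast_eq_zero_iff]
    exact fun h => absurd (Nat.le_of_dvd hi h) (not_le.2 hiN)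
  rw [GaugeField.ctwist_apply, if_neg (fun h => hc h.2)]
  rfl

/-- The twisted bond variable read in `M₂(ℂ)ˣ` has value `−1`. [cite: tHooft1979Flux, §2; Balaban1985Averaging, (19) p.21] -/
theorem val_unitsField_cycle_zero :
    ((unitsField (toUField ((1 : GaugeField P 0 (Matrix.specialUnitaryGroup (Fin 2) ℂ)).ctwist negOne₂ μ s₀))
        ⟨transl (0 : Site P 0) (((s₀.val : ℤ) + ((0 : ℕ) : ℤ)) • e μ), μ⟩ : (Matrix (Fin 2) (Fin 2) ℂ)ˣ) : Matrix (Fin 2) (Fin 2) ℂ) = -1 := by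
  rw [val_unitsField]
  show ((B10Eq27TorusAxialLog.suIncl (((1 : GaugeField P 0 (Matrix.specialUnitaryGroup (Fin 2) ℂ)).ctwist negOne₂ μ s₀)
    ⟨transl (0 : Site P 0) (((s₀.val : ℤ) + ((0 : ℕ) : ℤ)) • e μ), μ⟩) : Matrix.unitaryGroup (Fin 2) ℂ) : Matrix (Fin 2) (Fin 2) ℂ) = -1
  rw [ctwist_one_cycle_zero, val_suIncl]
  rfl

/-- The untwisted bond variables read in `M₂(ℂ)ˣ` are `1`. [cite: tHooft1979Flux, §2; Balaban1985Averaging, (19) p.21] -/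
theorem unitsField_cycle_pos {i : ℕ} (hi : 0 < i) (hiN : i < P.sitesPerDir 0) :
    unitsField (toUField ((1 : GaugeField P 0 (Matrix.specialUnitaryGroup (Fin 2) ℂ)).ctwist negOne₂ μ s₀))
        ⟨transl (0 : Site P 0) (((s₀.val : ℤ) + (i : ℤ)) • e μ), μ⟩ = 1 := by
  apply Units.ext
  rw [val_unitsField]
  show ((B10Eq27TorusAxialLog.suIncl (((1 : GaugeField P 0 (Matrix.specialUnitaryGroup (Fin 2) ℂ)).ctwist negOne₂ μ s₀)
    ⟨transl (0 : Site P 0) (((s₀.val : ℤ) + (i : ℤ)) • e μ), μ⟩) : Matrix.unitaryGroup (Fin 2) ℂ) : Matrix (Fin 2) (Fin 2) ℂ) = _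
  rw [ctwist_one_cycle_pos μ s₀ hi hiN, val_suIncl]
  rfl

end Cycle

/-! ## §4 Small members: the top cube is the whole torus, every fine bond has top level and unit weight -/

section Small

open FlatCubeSequenceAligned (cubeSeqMT3 cubeSeqM cubeSeqM_Om_pos cubeFinM radM mem_cubeFinM_of_dist)
open FlatCubeOpsText (IsLevWeight)
open B5Eq117TorusCarriers (Mk)
open B5Eq118OneStroke (iterBlockOf)
open B5Prop12FieldsLattice (distSite)
open B6SectADomainsV1 (Domains)
open B11Eq115Space (levOf)
open B8Eq140Level (SideTouches sideTouches_of_bondTouches)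
open B8Ineq132 (BondTouches)
open B8Thm2SetupTorus (pullDom mem_pullSet)

variable {P : Params}

/-- The sup circular distance on the level-`j` torus never exceeds half the period. [cite: Balaban1984PropagatorsI, (1.110) p.35] -/
theorem distSite_le_half (j : ℕ) (y y' : Site P j) : distSite (Mk P j) y y' ≤ ((P.sitesPerDir j / 2 : ℕ) : ℝ) := by
  unfold distSite
  exact_mod_cast Finset.sup_le fun ν _ => ZMod.natAbs_valMinAbs_le (y ν - y' ν)

variable (F : T3Family) (n K : ℕ)

/-- **WRAPPING**: if the top torus has at most `2ρ + 1` sites per direction, the top cube `□_{K−n}` of the aligned sequence of ANY centre is the whole top torus.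
[cite: Balaban1985Variational, (144) p.300; Balaban1984PropagatorsII, (2.1) p.224] -/
theorem mem_cubeFinM_top_of_wrap {ρ : ℕ} (hwrap : (F.P K).sitesPerDir (K - n) / 2 ≤ ρ) (x : Site (F.P K) 0) (S M : ℕ)
    (y : Site (F.P K) (K - n)) : y ∈ cubeFinM x (K - n) ρ S M (K - n) := by
  refine mem_cubeFinM_of_dist x (K - n) ρ S M (K - n) ?_
  rw [Nat.sub_self]
  exact (distSite_le_half (K - n) y _).trans (by exact_mod_cast hwrap)

/-- Hence every fine site has top level `K − n` in the aligned sequence (`InOm (K−n)`). [cite: Balaban1985Variational, (144) p.300, p.286] -/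
theorem inOm_top_of_wrap (hnK : n < K) {ρ : ℕ} (hwrap : (F.P K).sitesPerDir (K - n) / 2 ≤ ρ) (x : Site (F.P K) 0) (S M : ℕ) (hM : 1 ≤ M)
    (y : Site (F.P K) 0) : (cubeSeqMT3 F n K x ρ S M hM).InOm (K - n) y := by
  show iterBlockOf (K - n) y ∈ (cubeSeqMT3 F n K x ρ S M hM).Om (K - n)
  unfold cubeSeqMT3
  rw [cubeSeqM_Om_pos x _ ρ S M hM (by omega) le_rfl]
  exact mem_cubeFinM_top_of_wrap F n K hwrap x S M _

/-- … so its level `j(y)` is `K − n`. [cite: Balaban1985Variational, p.286] -/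
theorem levOf_top_of_wrap (hnK : n < K) {ρ : ℕ} (hwrap : (F.P K).sitesPerDir (K - n) / 2 ≤ ρ) (x : Site (F.P K) 0) (S M : ℕ) (hM : 1 ≤ M)
    (y : Site (F.P K) 0) : levOf (fun j => {z : Site (F.P K) 0 | (cubeSeqMT3 F n K x ρ S M hM).InOm j z}) (K - n) y = K - n :=
  (FlatCubeLevels.levOf_inOm_eq_top_iff (cubeSeqMT3 F n K x ρ S M hM) y).2 (inOm_top_of_wrap F n K hnK hwrap x S M hM y)

/-- … and every level weight of (152) equals `1` at first order on every fine bond. [cite: Balaban1985Variational, (152) p.301] -/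
theorem levWeight_one_of_wrap (hnK : n < K) {ρ : ℕ} (hwrap : (F.P K).sitesPerDir (K - n) / 2 ≤ ρ) (x : Site (F.P K) 0) (S M : ℕ) (hM : 1 ≤ M)
    {w : ℕ → PBond (F.P K) 0 → ℝ} (hw : IsLevWeight F n K (cubeSeqMT3 F n K x ρ S M hM) w) (b : PBond (F.P K) 0) : w 1 b = 1 := by
  rw [hw 1 b, levOf_top_of_wrap F n K hnK hwrap x S M hM, pow_one, ← mul_pow, mul_inv_cancel₀ (ne_of_gt (L_cast_pos F)), one_pow]

/-- … and every fine bond `⟨0 + z, μ⟩` side-touches the top layer `pullDom {InOm (K−n)} (K−n)`. [cite: Balaban1985RegularSpaces, p.77 (convention before (1.5))] -/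
theorem sideTouches_top_of_wrap (hnK : n < K) {ρ : ℕ} (hwrap : (F.P K).sitesPerDir (K - n) / 2 ≤ ρ) (x : Site (F.P K) 0) (S M : ℕ) (hM : 1 ≤ M)
    (z : B7Prop1Explicit.Site (F.P K).d) (μ : Fin (F.P K).d) :
    SideTouches (pullDom (fun i => {y : Site (F.P K) 0 | (cubeSeqMT3 F n K x ρ S M hM).InOm i y}) (K - n)) z μ := by
  obtain ⟨κ, hκ⟩ : ∃ κ : Fin (F.P K).d, κ ≠ μ := by
    by_cases h : μ.val = 0
    · exact ⟨⟨1, by rw [T3Family.P_d]; norm_num⟩, fun e => by rw [Fin.ext_iff] at e; simp at e; omega⟩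
    · exact ⟨⟨0, by rw [T3Family.P_d]; norm_num⟩, fun e => h (by rw [← e])⟩
  refine sideTouches_of_bondTouches hκ (Or.inl ?_)
  show z ∈ B8Thm2SetupTorus.pullSet {y : Site (F.P K) 0 | (cubeSeqMT3 F n K x ρ S M hM).InOm (K - n) y} 0
  rw [mem_pullSet]
  exact inOm_top_of_wrap F n K hnK hwrap x S M hM _

end Small

/-! ## §5 Telescoping along a cycle; a product estimate -/

section Algebra

/-- **TELESCOPING**: chart identities `gᵢ⁻¹·Wᵢ·gᵢ₊₁ = Eᵢ` along a path multiply to `g₀⁻¹·(∏Wᵢ)·g_N = ∏Eᵢ` (ordered products). [folklore] -/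
theorem prod_telescope {G : Type*} [Group G] (g W E : ℕ → G) :
    ∀ N : ℕ, (∀ i, i < N → (g i)⁻¹ * W i * g (i + 1) = E i) →
      (g 0)⁻¹ * ((List.range N).map W).prod * g N = ((List.range N).map E).prod
  | 0, _ => by simp
  | N + 1, h => by
    rw [List.range_succ, List.map_append, List.prod_append, List.map_append, List.prod_append, List.map_singleton,
      List.prod_singleton, List.map_singleton, List.prod_singleton,
      ← prod_telescope g W E N (fun i hi => h i (Nat.lt_succ_of_lt hi)), ← h N (Nat.lt_succ_self N)]
    simp [mul_assoc]

/-- A list product whose entries after the head are `1` is the head. [folklore] -/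
theorem prod_range_map_eq_head {M : Type*} [Monoid M] (W : ℕ → M) {N : ℕ} (hN : 0 < N)
    (h1 : ∀ i, 0 < i → i < N → W i = 1) : ((List.range N).map W).prod = W 0 := by
  obtain ⟨N, rfl⟩ := Nat.exists_eq_succ_of_ne_zero hN.ne'
  rw [List.range_succ_eq_map, List.map_cons, List.prod_cons, List.map_map]
  have : ((List.range N).map (W ∘ Nat.succ)).prod = 1 := List.prod_eq_one (by
    intro x hx
    rw [List.mem_map] at hx
    obtain ⟨i, hi, rfl⟩ := hx
    rw [List.mem_range] at hi
    exact h1 _ (Nat.succ_pos i) (by omega))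
  rw [this, mul_one]

/-- **PRODUCT ESTIMATE**: if every factor is within `t ≥ 0` of `1`, an ordered product of `n` factors is within `(1+t)ⁿ − 1` of `1`
(sub-multiplicativity only). [folklore] -/
theorem norm_list_prod_sub_one_le {𝔸 : Type*} [NormedRing 𝔸] [NormOneClass 𝔸] {t : ℝ} (ht : 0 ≤ t) :
    ∀ l : List 𝔸, (∀ X ∈ l, ‖X - 1‖ ≤ t) → ‖l.prod - 1‖ ≤ (1 + t) ^ l.length - 1
  | [], _ => by simp
  | X :: l, h => by
    rw [List.prod_cons, List.length_cons, pow_succ']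
    have hX : ‖X - 1‖ ≤ t := h X (by simp)
    have hl : ‖l.prod - 1‖ ≤ (1 + t) ^ l.length - 1 := norm_list_prod_sub_one_le ht l (fun Y hY => h Y (by simp [hY]))
    have hs : 0 ≤ (1 + t) ^ l.length - 1 := by
      have : (1 : ℝ) ≤ (1 + t) ^ l.length := one_le_pow₀ (by linarith)
      linarith
    have key : X * l.prod - 1 = (X - 1) * (l.prod - 1) + (X - 1) + (l.prod - 1) := by noncomm_ring
    rw [key]
    calc ‖(X - 1) * (l.prod - 1) + (X - 1) + (l.prod - 1)‖
        ≤ ‖(X - 1) * (l.prod - 1)‖ + ‖X - 1‖ + ‖l.prod - 1‖ := norm_add₃_le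
      _ ≤ ‖X - 1‖ * ‖l.prod - 1‖ + ‖X - 1‖ + ‖l.prod - 1‖ := by gcongr; exact norm_mul_le _ _
      _ ≤ t * ((1 + t) ^ l.length - 1) + t + ((1 + t) ^ l.length - 1) := by
        gcongr
      _ = (1 + t) * (1 + t) ^ l.length - 1 := by ring

end Algebra

end Summit.QuantumFields.YangMills.Theorems.HalvingP1FlatPillarWrapWitness

end
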